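import Mathlib.AlgebraicGeometry.IdealSheaf.Subscheme
import Mathlib.AlgebraicGeometry.Properties
import HarnessLib

/-!
# The closed subscheme of a radical ideal sheaf with irreducible support is integral

For a scheme `X` and an ideal sheaf `J : X.IdealSheafData` (Mathlib, affine-local form) with closed
subscheme `ι : Z = V(𝒥) ↪ X` (Mathlib `IdealSheafData.subscheme`, `subschemeι`):

* `isReduced_subscheme` — `Z` is reduced when `𝒥` is radical (its affine pieces are the spectra of
  the reduced rings `Γ(U, 𝒪_X)/𝒥(U)`, Mathlib `IdealSheafData.subschemeCover`);
* `irreducibleSpace_subscheme` — `Z` is irreducible when the support `V(𝒥)` is (the inclusion is an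
  embedding with image the support, Mathlib `range_subschemeι`);
* `isIntegral_subscheme` — hence `Z` is integral (Hartshorne II Prop. 3.1 / Ex. 3.?; Görtz–Wedhorn I,
  Prop. 3.27 with (3.13): reduced and irreducible);
* `subschemeι_app_eq_zero` — `ι^*` kills `𝒥` (Mathlib `ker_subschemeι_app`);
* `app_injective_of_surjective` — for `π : Y → Z` surjective onto a REDUCED scheme `Z`, every
  `π^* : Γ(U, 𝒪_Z) → Γ(π⁻¹U, 𝒪_Y)` is injective (a nonzero section of a reduced scheme is a unit
  somewhere, Mathlib `basicOpen_eq_bot_iff`).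

These are the scheme-theoretic preliminaries of the integral case of the dévissage
(Görtz–Wedhorn I, Lemma 12.63 (iii); II Thm. 23.17 proof). Everything is proved; no named facts.
Mathlib searched (pin v4.32): `IsReduced.of_openCover`, `isIntegral_of_irreducibleSpace_of_isReduced`,
`Ideal.isRadical_iff_quotient_reduced`, `IdealSheafData.range_subschemeι`, `ker_subschemeι_app`,
`basicOpen_eq_bot_iff`, `Scheme.preimage_basicOpen` (used).

## References

* U. Görtz, T. Wedhorn, *Algebraic Geometry I: Schemes*, 2nd ed. (2020): Prop. 3.27, Lemma 12.63 (iii).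
  [GortzWedhorn2020]
* R. Hartshorne, *Algebraic Geometry* (1977): II Prop. 3.1, II Example 3.2.6 / Prop. 4.? . [Hartshorne1977]
-/

noncomputable section

open CategoryTheory AlgebraicGeometry TopologicalSpace Opposite Topology

universe u

namespace Literature.AlgebraicGeometry.Morphisms

variable {X : Scheme.{u}} (J : X.IdealSheafData)

/-- **`V(𝒥)` is reduced for `𝒥` radical.** [cite: GortzWedhorn2020, Prop. 3.27] -/
theorem isReduced_subscheme (hJ : J.radical = J) : IsReduced J.subscheme := by
  haveI : ∀ U : X.affineOpens, _root_.IsReduced (Γ(X, (U : X.Opens)) ⧸ J.ideal U) := fun U => by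
    rw [← Ideal.isRadical_iff_quotient_reduced, ← Ideal.radical_eq_iff]
    have h := congrFun (congrArg Scheme.IdealSheafData.ideal hJ) U
    rwa [Scheme.IdealSheafData.radical_ideal] at h
  haveI : ∀ i, IsReduced (J.subschemeCover.openCover.X i) := fun i => by
    obtain ⟨U, rfl⟩ : ∃ U : X.affineOpens, U = i := ⟨i, rfl⟩
    change IsReduced (Spec (.of (Γ(X, (U : X.Opens)) ⧸ J.ideal U)))
    infer_instance
  exact IsReduced.of_openCover (𝒰 := J.subschemeCover.openCover)

/-- **`V(𝒥)` is irreducible when its support is.** [folklore] -/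
theorem irreducibleSpace_subscheme (hirr : IsIrreducible ((J.support : Closeds X) : Set X)) :
    IrreducibleSpace J.subscheme := by
  have hemb : IsEmbedding J.subschemeι.base := J.subschemeι.isEmbedding
  have hrange : Set.range J.subschemeι.base = (J.support : Set X) := J.range_subschemeι
  rw [irreducibleSpace_def]
  refine ⟨?_, ?_⟩
  · obtain ⟨x, hx⟩ := hirr.1
    rw [← hrange] at hx
    obtain ⟨z, rfl⟩ := hx
    exact ⟨z, trivial⟩
  · rintro u v hu hv ⟨a, -, ha⟩ ⟨b, -, hb⟩
    obtain ⟨u', hu', rfl⟩ := hemb.isOpen_iff.mp hu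
    obtain ⟨v', hv', rfl⟩ := hemb.isOpen_iff.mp hv
    obtain ⟨x, hx, hxu, hxv⟩ := hirr.2 u' v' hu' hv' ⟨_, hrange ▸ ⟨a, rfl⟩, ha⟩
      ⟨_, hrange ▸ ⟨b, rfl⟩, hb⟩
    rw [← hrange] at hx
    obtain ⟨z, rfl⟩ := hx
    exact ⟨z, trivial, hxu, hxv⟩

/-- **`V(𝒥)` is integral for `𝒥` radical with irreducible support.**
[cite: GortzWedhorn2020, Prop. 3.27] -/
theorem isIntegral_subscheme (hJ : J.radical = J) (hirr : IsIrreducible ((J.support : Closeds X) : Set X)) :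
    IsIntegral J.subscheme := by
  haveI := isReduced_subscheme J hJ
  haveI := irreducibleSpace_subscheme J hirr
  exact isIntegral_of_irreducibleSpace_of_isReduced _

/-- `ι^* : Γ(V, 𝒪_X) → Γ(ι⁻¹V, 𝒪_Z)` kills `𝒥(V)` for affine `V`. [folklore] -/
theorem subschemeι_app_eq_zero {V : X.affineOpens} {r : Γ(X, (V : X.Opens))} (hr : r ∈ J.ideal V) :
    J.subschemeι.app V r = 0 := by
  have h : r ∈ RingHom.ker (J.subschemeι.app V).hom := by
    rw [Scheme.IdealSheafData.ker_subschemeι_app]; exact hr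
  exact h

/-- **Pull-back of functions along a surjective morphism onto a reduced scheme is injective.**
[folklore] -/
theorem app_injective_of_surjective {Y Z : Scheme.{u}} (π : Y ⟶ Z) [IsReduced Z]
    (hπ : Function.Surjective π.base) (U : Z.Opens) : Function.Injective (π.app U) := by
  intro s t h
  rw [← sub_eq_zero] at h ⊢
  rw [← map_sub] at h
  set d := s - t
  by_contra hd
  have hne : Z.basicOpen d ≠ ⊥ := fun h0 => hd ((basicOpen_eq_bot_iff d).mp h0)
  obtain ⟨z, hz⟩ : ((Z.basicOpen d : Z.Opens) : Set Z).Nonempty := by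
    rw [Set.nonempty_iff_ne_empty]
    intro h0
    exact hne (Opens.ext h0)
  obtain ⟨y, rfl⟩ := hπ z
  have hy : y ∈ π ⁻¹ᵁ Z.basicOpen d := hz
  rw [Scheme.preimage_basicOpen, h, Scheme.basicOpen_zero] at hy
  exact hy

end Literature.AlgebraicGeometry.Morphisms

end
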